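import Summits.CriticalPhenomena.PercolationContinuityZ3.Theorems.PercNearOneGluingNoHeavyLowerTailSahiCombMixMixedFour
import Summits.CriticalPhenomena.PercolationContinuityZ3.Theorems.PercNearOneGluingNoHeavyLowerTailSahiMixtureMixedFour
import Summits.CriticalPhenomena.PercolationContinuityZ3.Theorems.PercNearOneGluingNoHeavyLowerTailSahiCombMixFourSingleFour

/-!
# The comb (tensor-Bernstein) hierarchy for Sahi's `E_k`, LII: building blocks for the mixed four-event singleton cells — Venn moments off `e` and the
# coordinate basis `p_e, p_e(1−p_e), p_e(1−p_e)(2−p_e), p_e(1−p_e)(2−p_e)(3−p_e)`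

Support file of the one-cut programme (crux `NoHeavyLowerTail`, stmt-CriticalPhenomena-4575; cell `prim-masterthm`, seat P3, gen 9;
`run/shared/lean/prim/prim-masterthm/prim-masterthm-p3/HIERARCHY.md` §17(i)).  The closed identities of `…SahiMixtureMixedFour` express the six singleton mixed cells through
hereditary rows of the unmixed members and VENN MOMENTS (`μ(Ā∩D)`, `μ(A∩B̄∩D)`, `μ(D∖(A∩B))`, …); this file proves that each such moment of a family `U` ignoring `e` is
comb-positive at multidegree `1` off `e` (`combPos_lin_off` + instances; `combPos_diff/diff'`, `ind_U4_insert` reused from gen 8), that the coordinate basis functions are comb-positive along `e` (`combPos_coordBasis₂/₃/₄`), and the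
degree bookkeeping.  The cells themselves are in `…SahiCombMixMixedFourSingleCells`.  HONEST FRAMING: bookkeeping only. [this work]
-/

noncomputable section

open scoped Classical

namespace Summit.CriticalPhenomena.PercolationContinuityZ3.Theorems

open Finset Function
open Literature.Combinatorics.Sahi2008
open Literature.Probability.Percolation.BHK2006 (ind_le_one ind_inter)
open Literature.Probability.Percolation.DecisionTree (ind ind_of_mem ind_of_not_mem ind_nonneg)
open SahiComb
open SahiCombHereditary (CombHereditary)

variable {ι : Type} [Fintype ι]

namespace SahiCombMix

/-! ### Coordinate basis along `e` -/

omit [Fintype ι] in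
/-- `Pi.single e k ≤ Pi.single e m` for `k ≤ m`. [folklore] -/
theorem single_le_single' (e : ι) {k m : ℕ} (h : k ≤ m) : (Pi.single e k : ι → ℕ) ≤ Pi.single e m := fun x => by
  by_cases hx : x = e
  · subst hx; simp [h]
  · simp [hx]

/-- `p_e(1−p_e)(2−p_e)` is comb-positive at degree `3` along `e`. [this work] -/
theorem combPos_coordBasis₃ (e : ι) : CombPos (Pi.single e 3) (fun p : ι → unitInterval => (p e : ℝ) * (1 - (p e : ℝ)) * (2 - (p e : ℝ))) :=
  ((SahiCombDisjunct.combPos_coord_pow e 1 2).add ((SahiCombDisjunct.combPos_coord_pow e 1 1).mono (single_le_single' e (by norm_num)))).congr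
    fun p => by ring

/-- `p_e(1−p_e)(2−p_e)(3−p_e)` is comb-positive at degree `4` along `e`. [this work] -/
theorem combPos_coordBasis₄ (e : ι) :
    CombPos (Pi.single e 4) (fun p : ι → unitInterval => (p e : ℝ) * (1 - (p e : ℝ)) * (2 - (p e : ℝ)) * (3 - (p e : ℝ))) :=
  (((SahiCombDisjunct.combPos_coord_pow e 1 3).add (((SahiCombDisjunct.combPos_coord_pow e 1 2).mono (single_le_single' e (by norm_num))).smul
    (by norm_num : (0:ℝ) ≤ 3))).add (((SahiCombDisjunct.combPos_coord_pow e 1 1).mono (single_le_single' e (by norm_num))).smul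
    (by norm_num : (0:ℝ) ≤ 2))).congr fun p => by ring

omit [Fintype ι] in
/-- Degree bookkeeping along `e` for quartic cells. [folklore] -/
theorem deg4_single_add (e : ι) (k : ℕ) (hk : k ≤ 4) : (Pi.single e k + update (fun _ : ι => 4) e 0) ≤ fun _ : ι => 4 := fun x => by
  by_cases hx : x = e
  · subst hx; simp [hk]
  · simp [hx]

/-! ### Venn moments of a family ignoring `e` are comb-positive at degree `1` off `e` -/

/-- **A nonnegative function ignoring `e` has comb-positive expectation at multidegree `1` off `e`**, in any closed form `g` of that expectation. [this work] -/
theorem combPos_lin_off (e : ι) (f : Set ι → ℝ) (hf0 : ∀ ω, 0 ≤ f ω) (hfe : ∀ ω, f (insert e ω) = f ω) (g : (ι → unitInterval) → ℝ)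
    (hg : ∀ p, ex (bernoulliWeight p) f = g p) : CombPos (update (fun _ : ι => 1) e 0) g :=
  ((combPos_ex (ι := ι) hf0).of_ignores e fun p s => SahiCombDisjunct.ex_update_of_ignores' e hfe p s).congr fun p => (hg p).symm

section Pieces

variable (U : Fin 4 → Set (Set ι)) (e : ι) (hUe : ∀ (j : Fin 4) (b : Bool), secAt e b (U j) = U j)
include hUe

/-- `μ(U_j)`. [this work] -/
theorem cP_mem (j : Fin 4) : CombPos (update (fun _ : ι => 1) e 0) (fun p => ex (bernoulliWeight p) (ind (U j))) :=
  combPos_lin_off e (ind (U j)) (ind_nonneg _) (ind_U4_insert U e hUe j) _ fun _ => rfl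

/-- `a − μ(U_j)` for `a ≥ 1`. [this work] -/
theorem cP_const_sub (j : Fin 4) {a : ℝ} (ha : 1 ≤ a) : CombPos (update (fun _ : ι => 1) e 0) (fun p => a - ex (bernoulliWeight p) (ind (U j))) := by
  refine combPos_lin_off e (fun ω => a - ind (U j) ω) (fun ω => sub_nonneg.2 ((ind_le_one _ ω).trans ha)) (fun ω => by rw [ind_U4_insert U e hUe]) _
    fun p => ?_
  have ee := SahiMixture.ex_eq_lin (bernoulliWeight p) (fun ω => a - ind (U j) ω) ![a, -1] ![fun _ => 1, ind (U j)] (fun ω => by simp [Fin.sum_univ_succ]; ring)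
  simp only [Fin.sum_univ_succ, Fin.sum_univ_zero, Matrix.cons_val_zero, Matrix.cons_val_succ, ex_const (sum_bernoulliWeight p)] at ee
  rw [ee]; ring

/-- `μ(U_j U_k)`. [this work] -/
theorem cP_mem2 (j k : Fin 4) : CombPos (update (fun _ : ι => 1) e 0) (fun p => ex (bernoulliWeight p) (ind (U j) * ind (U k))) :=
  combPos_lin_off e (ind (U j) * ind (U k)) (fun ω => mul_nonneg (ind_nonneg _ ω) (ind_nonneg _ ω))
    (fun ω => by simp only [Pi.mul_apply]; rw [ind_U4_insert U e hUe, ind_U4_insert U e hUe]) _ fun _ => rfl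

/-- `1 − μ(U_j U_k)`. [this work] -/
theorem cP_one_sub_mem2 (j k : Fin 4) : CombPos (update (fun _ : ι => 1) e 0) (fun p => 1 - ex (bernoulliWeight p) (ind (U j) * ind (U k))) := by
  refine combPos_lin_off e (fun ω => 1 - ind (U j) ω * ind (U k) ω)
    (fun ω => sub_nonneg.2 (by nlinarith [ind_nonneg (U j) ω, ind_le_one (U j) ω, ind_nonneg (U k) ω, ind_le_one (U k) ω]))
    (fun ω => by rw [ind_U4_insert U e hUe, ind_U4_insert U e hUe]) _ fun p => ?_
  have ee := SahiMixture.ex_eq_lin (bernoulliWeight p) (fun ω => 1 - ind (U j) ω * ind (U k) ω) ![1, -1] ![fun _ => 1, ind (U j) * ind (U k)]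
    (fun ω => by simp [Fin.sum_univ_succ]; ring)
  simp only [Fin.sum_univ_succ, Fin.sum_univ_zero, Matrix.cons_val_zero, Matrix.cons_val_succ, ex_const (sum_bernoulliWeight p)] at ee
  rw [ee]; ring

/-- `μ(U_j U_k ∖ U_l) = μ(U_j U_k) − μ(U_j U_k U_l)` (third factor LAST in the product). [this work] -/
theorem cP_mem2_diff_last (j k l : Fin 4) :
    CombPos (update (fun _ : ι => 1) e 0) (fun p => ex (bernoulliWeight p) (ind (U j) * ind (U k)) - ex (bernoulliWeight p) (ind (U j) * ind (U k) * ind (U l))) := by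
  refine combPos_lin_off e (fun ω => ind (U j) ω * ind (U k) ω * (1 - ind (U l) ω))
    (fun ω => mul_nonneg (mul_nonneg (ind_nonneg _ ω) (ind_nonneg _ ω)) (sub_nonneg.2 (ind_le_one _ ω)))
    (fun ω => by rw [ind_U4_insert U e hUe, ind_U4_insert U e hUe, ind_U4_insert U e hUe]) _ fun p => ?_
  have ee := SahiMixture.ex_eq_lin (bernoulliWeight p) (fun ω => ind (U j) ω * ind (U k) ω * (1 - ind (U l) ω)) ![1, -1]
    ![ind (U j) * ind (U k), ind (U j) * ind (U k) * ind (U l)] (fun ω => by simp [Fin.sum_univ_succ]; ring)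
  simp only [Fin.sum_univ_succ, Fin.sum_univ_zero, Matrix.cons_val_zero, Matrix.cons_val_succ] at ee
  rw [ee]; ring

/-- `μ(U_k U_l ∖ U_j) = μ(U_k U_l) − μ(U_j U_k U_l)` (complemented factor FIRST in the product). [this work] -/
theorem cP_mem2_diff_first (j k l : Fin 4) :
    CombPos (update (fun _ : ι => 1) e 0) (fun p => ex (bernoulliWeight p) (ind (U k) * ind (U l)) - ex (bernoulliWeight p) (ind (U j) * ind (U k) * ind (U l))) := by
  refine combPos_lin_off e (fun ω => (1 - ind (U j) ω) * ind (U k) ω * ind (U l) ω)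
    (fun ω => mul_nonneg (mul_nonneg (sub_nonneg.2 (ind_le_one _ ω)) (ind_nonneg _ ω)) (ind_nonneg _ ω))
    (fun ω => by rw [ind_U4_insert U e hUe, ind_U4_insert U e hUe, ind_U4_insert U e hUe]) _ fun p => ?_
  have ee := SahiMixture.ex_eq_lin (bernoulliWeight p) (fun ω => (1 - ind (U j) ω) * ind (U k) ω * ind (U l) ω) ![1, -1]
    ![ind (U k) * ind (U l), ind (U j) * ind (U k) * ind (U l)] (fun ω => by simp [Fin.sum_univ_succ]; ring)
  simp only [Fin.sum_univ_succ, Fin.sum_univ_zero, Matrix.cons_val_zero, Matrix.cons_val_succ] at ee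
  rw [ee]; ring

/-- `μ(U_j Ū_k U_l) = μ(U_j U_l) − μ(U_j U_k U_l)` (complemented factor in the MIDDLE). [this work] -/
theorem cP_mem2_diff_mid (j k l : Fin 4) :
    CombPos (update (fun _ : ι => 1) e 0) (fun p => ex (bernoulliWeight p) (ind (U j) * ind (U l)) - ex (bernoulliWeight p) (ind (U j) * ind (U k) * ind (U l))) := by
  refine combPos_lin_off e (fun ω => ind (U j) ω * (1 - ind (U k) ω) * ind (U l) ω)
    (fun ω => mul_nonneg (mul_nonneg (ind_nonneg _ ω) (sub_nonneg.2 (ind_le_one _ ω))) (ind_nonneg _ ω))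
    (fun ω => by rw [ind_U4_insert U e hUe, ind_U4_insert U e hUe, ind_U4_insert U e hUe]) _ fun p => ?_
  have ee := SahiMixture.ex_eq_lin (bernoulliWeight p) (fun ω => ind (U j) ω * (1 - ind (U k) ω) * ind (U l) ω) ![1, -1]
    ![ind (U j) * ind (U l), ind (U j) * ind (U k) * ind (U l)] (fun ω => by simp [Fin.sum_univ_succ]; ring)
  simp only [Fin.sum_univ_succ, Fin.sum_univ_zero, Matrix.cons_val_zero, Matrix.cons_val_succ] at ee
  rw [ee]; ring

/-- `μ(U_l ∖ (U_j U_k)) = μ(U_l) − μ(U_j U_k U_l)`. [this work] -/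
theorem cP_mem_diff_mem3 (j k l : Fin 4) :
    CombPos (update (fun _ : ι => 1) e 0) (fun p => ex (bernoulliWeight p) (ind (U l)) - ex (bernoulliWeight p) (ind (U j) * ind (U k) * ind (U l))) := by
  refine combPos_lin_off e (fun ω => (1 - ind (U j) ω * ind (U k) ω) * ind (U l) ω)
    (fun ω => mul_nonneg (sub_nonneg.2 (by nlinarith [ind_nonneg (U j) ω, ind_le_one (U j) ω, ind_nonneg (U k) ω, ind_le_one (U k) ω]))
      (ind_nonneg _ ω))
    (fun ω => by rw [ind_U4_insert U e hUe, ind_U4_insert U e hUe, ind_U4_insert U e hUe]) _ fun p => ?_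
  have ee := SahiMixture.ex_eq_lin (bernoulliWeight p) (fun ω => (1 - ind (U j) ω * ind (U k) ω) * ind (U l) ω) ![1, -1]
    ![ind (U l), ind (U j) * ind (U k) * ind (U l)] (fun ω => by simp [Fin.sum_univ_succ]; ring)
  simp only [Fin.sum_univ_succ, Fin.sum_univ_zero, Matrix.cons_val_zero, Matrix.cons_val_succ] at ee
  rw [ee]; ring

/-- The hereditary covariance row `Cov(U_j, U_k)`, degree `2` off `e`. [this work] -/
theorem cP_cov (hU : CombHereditary U) (j k : Fin 4) :
    CombPos (update (fun _ : ι => 2) e 0) (fun p => ex (bernoulliWeight p) (ind (U j) * ind (U k))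
      - ex (bernoulliWeight p) (ind (U j)) * ex (bernoulliWeight p) (ind (U k))) := by
  have r2 := hU.row_off e hUe 2 ![({j} : Finset (Fin 4)), {k}]
  have eC : (fun l => ind (⋂ i ∈ (![({j} : Finset (Fin 4)), {k}] : Fin 2 → Finset (Fin 4)) l, U i)) = ![ind (U j), ind (U k)] := by
    funext l; fin_cases l <;> simp
  rw [eC] at r2
  refine r2.congr fun p => ?_
  rw [sahiE_two_apply]
  simp only [Matrix.cons_val_zero, Matrix.cons_val_one]

/-- The hereditary cubic row `E_3(U_j, U_k, U_l)`, degree `3` off `e`. [this work] -/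
theorem cP_E3 (hU : CombHereditary U) (j k l : Fin 4) :
    CombPos (update (fun _ : ι => 3) e 0) (fun p => sahiE (bernoulliWeight p) 3 ![ind (U j), ind (U k), ind (U l)]) := by
  have r3 := hU.row_off e hUe 3 ![({j} : Finset (Fin 4)), {k}, {l}]
  have eC : (fun x => ind (⋂ i ∈ (![({j} : Finset (Fin 4)), {k}, {l}] : Fin 3 → Finset (Fin 4)) x, U i)) = ![ind (U j), ind (U k), ind (U l)] := by
    funext x; fin_cases x <;> simp
  rw [eC] at r3
  exact r3

end Pieces

/-! ### Degree arithmetic off `e` -/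


omit [Fintype ι] in
/-- `update a e 0 + update b e 0 ≤ update m e 0` when `a + b ≤ m`. [folklore] -/
theorem deg_off_add_le' (e : ι) {a b m : ℕ} (h : a + b ≤ m) :
    update (fun _ : ι => a) e 0 + update (fun _ : ι => b) e 0 ≤ update (fun _ : ι => m) e 0 := by
  intro x; by_cases hx : x = e
  · subst hx; simp
  · simp [hx, h]

/-- Product of two functionals comb-positive off `e`, with the degree bound folded in. [this work] -/
theorem _root_.Summit.CriticalPhenomena.PercolationContinuityZ3.Theorems.SahiComb.CombPos.mul_off (e : ι) {a b m : ℕ}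
    {F G : (ι → unitInterval) → ℝ} (hF : CombPos (update (fun _ : ι => a) e 0) F) (hG : CombPos (update (fun _ : ι => b) e 0) G) (h : a + b ≤ m) :
    CombPos (update (fun _ : ι => m) e 0) (fun p => F p * G p) :=
  hF.mul_of_le hG (deg_off_add_le' e h)

end SahiCombMix

end Summit.CriticalPhenomena.PercolationContinuityZ3.Theorems

end
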